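import Literature.MathematicalPhysics.AQFT.OSAxiomsSchwinger
import Literature.MathematicalPhysics.AQFT.MassGapOS
import HarnessLib

/-!
# Osterwalder–Schrader data: a Euclidean QFT as a bundle (Schwinger functions + axioms as fields)

Draft Literature file (docs/m5/drafts; D-0015 / D-0017 / D-0018(2) redesign of
`QuantumFields := YangMills ∧ QCD`). Interface level: the TYPE over which "a quantum field theory
exists on `ℝ⁴`" quantifies — species type `ι` a parameter (for Yang–Mills: ALL gauge-invariant
local lattice observables of the gauge group `G`, `YMSpecies G`) — and the predicates every such
statement needs (full-spectrum mass gap, non-triviality); the tie to a specific dynamics is a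
separate predicate (`IsYangMillsFor`, `IsQCDFor` in the sibling drafts).

## Source and reading

Jaffe–Witten, *Quantum Yang–Mills theory* (Clay 2000), §3: "the Hilbert space `H` of the quantum
field carr[ies] a representation of the Poincaré group … positive energy, `0 ≤ H`, and a vacuum
vector `Ω ∈ H` that is unique up to a phase. Gauge-invariant functions of the quantum fields also
act as linear transformations on `H` … Osterwalder and Schrader then discovered the elementary
'reflection-positivity' condition … [35]"; §4: "Existence includes establishing axiomatic
properties at least as strong as those cited in [45, 35]" ([45] Streater–Wightman, [35] OS
1973/1975). We take the **Euclidean side of [35]**: Schwinger functions of hermitian scalar local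
fields (labels `ι`) as distributions on `⁰𝒮`, satisfying E0 (normalisation, hermiticity), E0'
(linear growth, OS 1975), E1 (Euclidean invariance), E2 (reflection positivity), E3 (symmetry),
E4 (cluster property) — exactly the hypotheses of the OS reconstruction theorem [OS 1975, Thm.
E→R], so that the Wightman theory of [45] is *derived*. The axioms are the tree's predicates
(`AQFT/OSAxiomsSchwinger.lean`); here they are FIELDS of `OSData`.

## Contents

* `OSData ι d` — Schwinger functions + E0, E0', E1–E4 as fields; `OSData.osAxioms`,
  `OSData.ofAxioms` (equivalence with the tree's `OSAxiomsSchwinger`).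
* `LabelledSchwingerFamily.HasMassGap`, `OSData.HasMassGap T Δ` — Jaffe–Witten's mass gap (§4:
  "`H` has no spectrum in `(0, Δ)`") through OS reconstruction [Glimm–Jaffe Thm. 6.1.3]: uniform
  exponential clustering at rate `Δ` of the truncated Schwinger functions of ALL species strings
  = `σ(H) ⊆ {0} ∪ [Δ, ∞)`, `0` simple, on the FULL reconstructed Hilbert space of `T`;
  `HasMassGap.restrict` (full ⇒ every sector); for one field = tree `MassGapOS` (`massGapOS_iff`).
* `OSData.IsNontrivial T s` (field `s` is not a c-number; forces `m < ∞`), `OSData.IsNonGaussian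
  T s` (some connected three-point function on `⁰𝒮` is nonzero: not a generalised free field).
* Non-vacuity of the TYPE: `OSData.vacuum` (the vacuum-only theory; it has every mass gap and is
  neither `IsNontrivial` nor `IsNonGaussian` — `vacuum_hasMassGap`, `not_isNontrivial_vacuum`,
  `not_isNonGaussian_vacuum`): statements over `OSData` must carry these clauses.
-/

open scoped SchwartzMap
open MeasureTheory Filter Topology Complex
open Literature.MathematicalPhysics.AQFT Literature.MathematicalPhysics.QuantumLattice

noncomputable section

namespace Literature.MathematicalPhysics.QuantumFieldTheory

/-- **Osterwalder–Schrader data** for a family of hermitian scalar Euclidean fields labelled by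
`ι` on `ℝ^d` (time = coordinate `0`): the Schwinger functions
`𝔖ₙ^{k₁…kₙ} ∈ 𝒮'((ℝ^d)ⁿ)` (values used only on `⁰𝒮`) together with the axioms
E0 (`𝔖₀ = 1`, hermiticity), E0' (linear growth), E1 (`SO(d) ⋉ ℝ^d` invariance), E2 (reflection
positivity), E3 (symmetry), E4 (cluster property) as FIELDS. This is "a quantum field theory in
the sense of [35]" of Jaffe–Witten §3–§4; by OS reconstruction it yields the Wightman theory of
[45]. [cite: OsterwalderSchrader1975, §2 (E0'), Thm. E→R] [cite: JaffeWitten2000, §3–§4] -/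
structure OSData (ι : Type) (d : ℕ) [NeZero d] where
  /-- The Schwinger functions `𝔖ₙ^{k}`, one tempered distribution per label string. -/
  schwinger : LabelledSchwingerFamily ι (EuclideanSpace ℝ (Fin d))
  /-- E0 (normalisation): `𝔖₀ = 1`. [OS 1973, §3 (E0)] -/
  normalized : schwinger.IsNormalized
  /-- E0 (hermiticity): `𝔖ₙ(f) = conj 𝔖ₙ^{rev}(Θf*)` on time-ordered `f`. [OS 1973, §3 (E0)] -/
  hermitian : schwinger.IsHermitian
  /-- E0' (linear growth, OS 1975 §2): `|𝔖ₙ(f)| ≤ α (n!)^β |f|_{ns}` on `⁰𝒮`. -/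
  linearGrowth : schwinger.HasLinearGrowth
  /-- E1: invariance under translations and proper rotations, on `⁰𝒮`. [OS 1973, §3 (E1)] -/
  invariant : schwinger.IsEuclideanInvariant
  /-- E2: reflection positivity on time-ordered sequences. [OS 1973, §3 (E2), (4.2)] -/
  reflectionPositive : schwinger.IsReflectionPositive
  /-- E3: symmetry (bosonic fields). [OS 1973, §3 (E3)] -/
  symmetric : schwinger.IsSymmetric
  /-- E4: cluster property. [OS 1973, §3 (E4)] -/
  cluster : schwinger.HasClusterProperty

namespace OSData

variable {ι : Type} {d : ℕ} [NeZero d]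

/-- The fields of `OSData` are exactly the tree's OS package `OSAxiomsSchwinger` (E0', E0–E4).
[cite: OsterwalderSchrader1975, §2] -/
theorem osAxioms (T : OSData ι d) : OSAxiomsSchwinger T.schwinger where
  normalized := T.normalized
  hermitian := T.hermitian
  invariant := T.invariant
  reflectionPositive := T.reflectionPositive
  symmetric := T.symmetric
  cluster := T.cluster
  linearGrowth := T.linearGrowth

/-- Conversely a labelled Schwinger family satisfying `OSAxiomsSchwinger` is an `OSData`.
[cite: OsterwalderSchrader1975, §2] -/
def ofAxioms (S : LabelledSchwingerFamily ι (EuclideanSpace ℝ (Fin d)))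
    (h : OSAxiomsSchwinger S) : OSData ι d where
  schwinger := S
  normalized := h.normalized
  hermitian := h.hermitian
  linearGrowth := h.linearGrowth
  invariant := h.invariant
  reflectionPositive := h.reflectionPositive
  symmetric := h.symmetric
  cluster := h.cluster

/-- `ofAxioms` keeps the Schwinger functions. [folklore] -/
@[simp] theorem ofAxioms_schwinger (S : LabelledSchwingerFamily ι (EuclideanSpace ℝ (Fin d)))
    (h : OSAxiomsSchwinger S) : (ofAxioms S h).schwinger = S := rfl

/-- **Uniform exponential clustering at rate `Δ` of ALL truncated Schwinger functions** of a
labelled family: for ALL label strings `k, k'` (every species, every arity) and all time-ordered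
`F, G` there is `C` with
`‖𝔖_{n+m}^{rev k ++ k'}(ΘF* ⊗ T_t G) − 𝔖ₙ^{rev k}(ΘF*) 𝔖ₘ^{k'}(G)‖ ≤ C e^{−Δt}` for all `t ≥ 0`.
**Full-spectrum reading.** OS reconstruction [Glimm–Jaffe Thm. 6.1.3; OS 1975 Thm. E→R] builds
the physical Hilbert space `ℋ_T` as the completion of the span of the vectors `Ψ_G^{k'}` (`G`
time-ordered, ALL label strings), `H ≥ 0` generating time translation; the bound reads
`|⟨Ψ_F^{k}, (e^{−tH} − |Ω⟩⟨Ω|) Ψ_G^{k'}⟩| ≤ C e^{−Δt}` on this TOTAL set, which by the spectral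
theorem is equivalent to: `0` is a simple eigenvalue of `H` (eigenvector `Ω`) and
`σ(H) ⊆ {0} ∪ [Δ, ∞)` on all of `ℋ_T` — Jaffe–Witten §4 "`H` has no spectrum in `(0, Δ)`" for the
FULL Hamiltonian of `T`, not for the cyclic subspace of one species (`HasMassGap.restrict`: full ⇒
sector, not conversely). Which space `ℋ_T` is depends only on which species `T` carries — for
Yang–Mills ALL gauge-invariant local observables (`YMSpecies G`). `0 < Δ` is NOT built in.
[cite: JaffeWitten2000, §4] [cite: GlimmJaffe1987, §6.1 Thm. 6.1.3 and §19] [cite: OS1973, §3 (E4)] -/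
def _root_.Literature.MathematicalPhysics.AQFT.LabelledSchwingerFamily.HasMassGap
    (S : LabelledSchwingerFamily ι (EuclideanSpace ℝ (Fin d))) (Δ : ℝ) : Prop :=
  ∀ (n m : ℕ) (k : Fin n → ι) (k' : Fin m → ι)
    (F : 𝓢((Fin n → EuclideanSpace ℝ (Fin d)), ℂ)) (G : 𝓢((Fin m → EuclideanSpace ℝ (Fin d)), ℂ)),
    IsTimeOrdered F → IsTimeOrdered G →
      ∃ C : ℝ, ∀ t : ℝ, 0 ≤ t →
        ∀ H : 𝓢((Fin (n + m) → EuclideanSpace ℝ (Fin d)), ℂ),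
          IsAppendTensorOf H (osAdjoint F) (translateMulti (EuclideanSpace.single 0 t) G) →
            ‖S (n + m) (Fin.append (k ∘ Fin.rev) k') H - S n (k ∘ Fin.rev) (osAdjoint F) * S m k' G‖
              ≤ C * Real.exp (-Δ * t)

/-- For one field the labelled gap is the tree's `MassGapOS` (which also records `0 < Δ`). [cite: JaffeWitten2000, §4] -/
theorem _root_.Literature.MathematicalPhysics.QuantumLattice.SchwingerFamily.massGapOS_iff_hasMassGap (S : SchwingerFamily (EuclideanSpace ℝ (Fin d))) (Δ : ℝ) :
    S.MassGapOS Δ ↔ 0 < Δ ∧ S.toLabelled.HasMassGap Δ := by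
  refine ⟨fun h => ⟨h.1, fun n m k k' F G hF hG => ?_⟩, fun h => ⟨h.1, fun n m F G hF hG => ?_⟩⟩
  · simpa using h.2 n m F G hF hG
  · simpa using h.2 n m (fun _ => ()) (fun _ => ()) F G hF hG

/-- **Full gap ⇒ sector gap.** Restricting the species along any `φ : κ → ι` (e.g. to the single
curvature field) preserves `HasMassGap Δ` (the gap of `H` on `ℋ_T` bounds the gap on every cyclic
subspace); the converse is false, which is why the statements cluster ALL species. [cite: GlimmJaffe1987, §6.1] -/
theorem _root_.Literature.MathematicalPhysics.AQFT.LabelledSchwingerFamily.HasMassGap.restrict {κ : Type}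
    {S : LabelledSchwingerFamily ι (EuclideanSpace ℝ (Fin d))} {Δ : ℝ} (h : S.HasMassGap Δ)
    (φ : κ → ι) : LabelledSchwingerFamily.HasMassGap (fun n k => S n (φ ∘ k)) Δ := by
  intro n m k k' F G hF hG
  obtain ⟨C, hC⟩ := h n m (φ ∘ k) (φ ∘ k') F G hF hG
  refine ⟨C, fun t ht H hH => ?_⟩
  have hφ : φ ∘ Fin.append (k ∘ Fin.rev) k' = Fin.append ((φ ∘ k) ∘ Fin.rev) (φ ∘ k') := by
    funext i; refine Fin.addCases (fun i => ?_) (fun i => ?_) i <;> simp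
  show ‖S (n + m) (φ ∘ Fin.append (k ∘ Fin.rev) k') H -
      S n ((φ ∘ k) ∘ Fin.rev) (osAdjoint F) * S m (φ ∘ k') G‖ ≤ _
  rw [hφ]; exact hC t ht H hH

/-- **Mass gap `Δ` of OS data — full spectrum** (Jaffe–Witten 2000, §4: "`H` has no spectrum in
the interval `(0, Δ)`"), Euclidean form: uniform exponential clustering at rate `Δ` of the
truncated Schwinger functions of ALL species strings of `T` = `σ(H) ⊆ {0} ∪ [Δ, ∞)`, `0` simple, on
the full OS-reconstructed Hilbert space of `T`. [cite: JaffeWitten2000, §4] [cite: GlimmJaffe1987, §6.1 Thm. 6.1.3 and §19] -/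
def HasMassGap (T : OSData ι d) (Δ : ℝ) : Prop := T.schwinger.HasMassGap Δ

/-- **Non-triviality of the field `s`** (Jaffe–Witten §4: "a non-trivial quantum Yang–Mills
theory"; also their "we require `m < ∞`"): the truncated two-point function of `φ_s` does not
vanish at some pair of time-separated arguments, `𝔖₂^{ss}(Θf* ⊗ g) ≠ 𝔖₁^{s}(Θf*) 𝔖₁^{s}(g)` for
some positive-time one-point `f, g` (reconstructed: `φ_s(g)Ω ∉ ℂΩ`, `φ_s` is not a c-number).
Excludes the vacuum-only theory, constant fields, white noise; NOT generalised free fields (job of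
`IsNonGaussian` and the dynamics predicate). [cite: JaffeWitten2000, §4] -/
def IsNontrivial (T : OSData ι d) (s : ι) : Prop :=
  ∃ (F G : 𝓢((Fin 1 → EuclideanSpace ℝ (Fin d)), ℂ))
    (H : 𝓢((Fin (1 + 1) → EuclideanSpace ℝ (Fin d)), ℂ)),
    IsTimeOrdered F ∧ IsTimeOrdered G ∧ IsAppendTensorOf H (osAdjoint F) G ∧
      T.schwinger (1 + 1) (fun _ => s) H ≠
        T.schwinger 1 (fun _ => s) (osAdjoint F) * T.schwinger 1 (fun _ => s) G

/-- **Non-Gaussianity of the field `s`** ("non-trivial" in the constructive sense: not a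
generalised free field; D-0015 "non-trivial (not Gaussian)"): the connected THREE-point function
of `φ_s` is nonzero on some tensor `f ⊗ g ⊗ h ∈ ⁰𝒮`,
`κ₃ = 𝔖₃(fgh) − 𝔖₁(f)𝔖₂(gh) − 𝔖₁(g)𝔖₂(fh) − 𝔖₁(h)𝔖₂(fg) + 2𝔖₁(f)𝔖₁(g)𝔖₁(h) ≠ 0` (witness form
for all sub-tensors). Gaussian fields have `κ₃ = 0`; also fails for the vacuum-only theory. For a
composite it does NOT by itself express "interacting constituents": the Wick square `:φ²:` of a
free SCALAR field passes it (`κ₃ = 8 C(x,y)C(y,z)C(z,x) ≠ 0`). CAVEAT for the composite it is applied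
to in the Yang–Mills statements (`LatticeRep.curvature`, continuum channel `tr F_{μν}F_{μν}`): the
`O(4)`-scalar Wick square of the FREE Euclidean Maxwell (or free-gluon) curvature in `d = 4` does NOT
pass it — its connected three-point function (indeed every odd truncated function) vanishes
identically on `⁰𝒮`, because the free field-strength two-point kernel anticommutes with the Hodge
star (electric–magnetic duality; kernel-checked as
`Summit.QuantumFields.YangMills.Theorems.SelfNormalisedSkewness.Negative.maxwellOddRing_eq_zero`,
`maxwellRing3_eq_zero`, `treeLevelSkewness_vanishes`). So for `tr F²` this clause excludes every
Gaussian / spin-wave / asymptotically-free-regime scaling limit (it forces interaction at the probed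
scale), while a single plane `F_{01}²` or a massive (Proca) curvature would pass it.
[cite: JaffeWitten2000, §4] [cite: GlimmJaffe1987, §6.1 (truncated functions)] -/
def IsNonGaussian (T : OSData ι d) (s : ι) : Prop :=
  ∃ (f g h : 𝓢(EuclideanSpace ℝ (Fin d), ℂ))
    (Ffgh : 𝓢((Fin 3 → EuclideanSpace ℝ (Fin d)), ℂ))
    (Fgh Ffh Ffg : 𝓢((Fin 2 → EuclideanSpace ℝ (Fin d)), ℂ))
    (Ff Fg Fh : 𝓢((Fin 1 → EuclideanSpace ℝ (Fin d)), ℂ)),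
    IsTensorOf Ffgh ![f, g, h] ∧ IsOffDiagonal Ffgh ∧
    IsTensorOf Fgh ![g, h] ∧ IsTensorOf Ffh ![f, h] ∧ IsTensorOf Ffg ![f, g] ∧
    IsTensorOf Ff ![f] ∧ IsTensorOf Fg ![g] ∧ IsTensorOf Fh ![h] ∧
      let S : (n : ℕ) → 𝓢((Fin n → EuclideanSpace ℝ (Fin d)), ℂ) → ℂ :=
        fun n F => T.schwinger n (fun _ => s) F
      S 3 Ffgh - S 1 Ff * S 2 Fgh - S 1 Fg * S 2 Ffh - S 1 Fh * S 2 Ffg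
        + 2 * (S 1 Ff * S 1 Fg * S 1 Fh) ≠ 0

variable (ι d) in
/-- **The vacuum-only theory** as OS data (`𝔖₀ = 1`, `𝔖ₙ = 0` for `n ≥ 1`; Hilbert space `ℂΩ`):
non-vacuity of the type `OSData ι d`, from the tree's `OSAxiomsSchwinger.trivial`. [folklore] -/
def vacuum : OSData ι d :=
  ofAxioms (LabelledSchwingerFamily.trivial ι (EuclideanSpace ℝ (Fin d)))
    (OSAxiomsSchwinger.trivial ι)

/-- The vacuum-only theory has every mass gap (`m = ∞` in Jaffe–Witten's terms): the junk case
that `IsNontrivial` removes. [folklore] -/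
theorem vacuum_hasMassGap (Δ : ℝ) : (vacuum ι d).HasMassGap Δ := by
  intro n m k k' F G _ _
  refine ⟨0, fun t _ H hH => ?_⟩
  rcases Nat.eq_zero_or_pos (n + m) with hnm | hnm
  · obtain ⟨rfl, rfl⟩ : n = 0 ∧ m = 0 := by omega
    haveI : IsEmpty (Fin (0 + 0)) := (inferInstance : IsEmpty (Fin 0))
    have h0 : (vacuum ι d).schwinger (0 + 0) (Fin.append (k ∘ Fin.rev) k') H =
        osAdjoint F 0 * G 0 := by
      change LabelledSchwingerFamily.trivial ι _ (0 + 0) (Fin.append (k ∘ Fin.rev) k') H = _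
      rw [LabelledSchwingerFamily.trivial_apply, if_pos rfl, hH, translateMulti_apply]
      congr 1; exact congrArg _ (Subsingleton.elim _ _)
    have h1 : (vacuum ι d).schwinger 0 (k ∘ Fin.rev) (osAdjoint F) = osAdjoint F 0 :=
      LabelledSchwingerFamily.trivial_zero_apply ι (k ∘ Fin.rev) _ 0
    have h2 : (vacuum ι d).schwinger 0 k' G = G 0 :=
      LabelledSchwingerFamily.trivial_zero_apply ι k' _ 0
    rw [h0, h1, h2, sub_self, norm_zero, zero_mul]
  · have h1 : (vacuum ι d).schwinger (n + m) (Fin.append (k ∘ Fin.rev) k') = 0 := by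
      simp [vacuum, LabelledSchwingerFamily.trivial_of_ne_zero ι hnm.ne']
    have h2 : (vacuum ι d).schwinger n (k ∘ Fin.rev) (osAdjoint F) *
        (vacuum ι d).schwinger m k' G = 0 := by
      rcases Nat.eq_zero_or_pos n with rfl | hn
      · have hm : m ≠ 0 := by omega
        simp [vacuum, LabelledSchwingerFamily.trivial_of_ne_zero ι hm]
      · simp [vacuum, LabelledSchwingerFamily.trivial_of_ne_zero ι hn.ne']
    simp [h1, h2]

/-- The vacuum-only theory is not non-trivial (in any field). [folklore] -/
theorem not_isNontrivial_vacuum (s : ι) : ¬(vacuum ι d).IsNontrivial s := by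
  rintro ⟨F, G, H, -, -, -, hne⟩
  apply hne
  simp [vacuum, LabelledSchwingerFamily.trivial_of_ne_zero ι (by norm_num : (1 + 1 : ℕ) ≠ 0),
    LabelledSchwingerFamily.trivial_of_ne_zero ι (by norm_num : (1 : ℕ) ≠ 0)]

/-- The vacuum-only theory is Gaussian (all its connected functions vanish). [folklore] -/
theorem not_isNonGaussian_vacuum (s : ι) : ¬(vacuum ι d).IsNonGaussian s := by
  rintro ⟨f, g, h, Ffgh, Fgh, Ffh, Ffg, Ff, Fg, Fh, -, -, -, -, -, -, -, -, hne⟩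
  apply hne
  simp [vacuum, LabelledSchwingerFamily.trivial_of_ne_zero ι (by norm_num : (3 : ℕ) ≠ 0),
    LabelledSchwingerFamily.trivial_of_ne_zero ι (by norm_num : (1 : ℕ) ≠ 0)]

end OSData

end Literature.MathematicalPhysics.QuantumFieldTheory

end
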